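import Summits.QuantumFields.YangMills.Theses.LangevinControlUV
import Summits.QuantumFields.YangMills.Theorems.ParabolicTrajectoryLatticeGapOnTrajectoryTransferSymDefs

/-!
# Restatement R6 of crux `GapToContinuum` (stmt-QuantumFields-8896) in slab-clustering currency — lead c2

Evidence file (rc 0, 0 sorries) for the tenure planner of route `LangevinControlUV`.  Four leads, two
triagers and the standing disproof certify the crux AS TYPED unprovable (D1/D2/D3b) and unrefutable in
practice.  This file adds to the re-type menu (R1 `Restatement.lean`, R4 `RestatementC1.lean`,
R5 `RestatementA1.lean`) the LATTICE-ONLY re-type in the currency that the sibling crux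
`LatticeGapOnTrajectory` (stmt-QuantumFields-10523) has made consumable (landed bridge
`Transfer.transferHalfSym_of_uniformSlabClustering`, p121787 + site RP p120012):

* `GapToContinuumSlab` — for all `G, r, sch, T, Δ > 0`: `M`-adic spacings, `HasWeakCouplingLimit`,
  physical volume growth `a_k L_k / log(a_k⁻¹) → ∞`, reflection-symmetric polynomially bounded
  renormalisations, `IsYangMillsFor r sch T` and UNIFORM SLAB CLUSTERING at rate `Δ`
  (cluster-expansion format, own tori) imply `T.HasMassGap Δ`.  **PROVED** (`gapToContinuumSlab_holds`;
  landed verbatim as `Theorems/LangevinControlUVGapToContinuumSlabTransfer.lean ::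
  gapToContinuum_slabTransfer`, p127362, `--supports 8896`).
* `OSLegsAtWeakCouplingSlab` — stmt-QuantumFields-16207 (`OSLegsAtWeakCouplingC`) VERBATIM with the
  witness clause extended by exactly the side conditions R6 consumes (M-adic shape, volume growth,
  reflection symmetry, polynomial renormalisations) and `∧ UniformSlabClustering r sch Δ` next to
  `HasLatticeMassGap r sch Δ` (same `Δ`).  It implies the current 16207 (`osLegsAtWeakCouplingC_of_slab`).
  All added clauses but the last are FREE for the witness builder (it chooses `β_k`, `L_k`, zeroes
  species symmetrically, `c_curv = a_k⁻⁴`); `exists_MAdic_weakCoupling` shows the `M`-adic clause is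
  consistent with `sch.a k = a (sch.β k)` for the CONTINUOUS unit map `a` of the C-variants (IVT).
  The last clause is the genuine content moved upstream: the IR leg must deliver clustering in
  cluster-expansion format (uniform over slab observables, constants polynomial in cutoff/volume),
  not per-pair constants.
* `closes_restatedSlab : FemtoCurvatureTwoPointC → FemtoCurvatureSkewnessC → LatticeGapInUVUnitsC →
  OSLegsAtWeakCouplingSlab → GapToContinuumSlab → YangMills` — the assembly re-closes (elaborates).

Planner action (one of): re-type 8896 := body of `GapToContinuumSlab` (closes at once `--by
Summit.QuantumFields.YangMills.Theorems.GapToContinuum.SlabTransfer.gapToContinuum_slabTransfer`) and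
16207 := body of `OSLegsAtWeakCouplingSlab`; or R1/R5 (conclusion-shaped hypotheses) if the transfer is
to stay inside 16207.  Do not re-arm crux-ideation on the typed text.
-/

noncomputable section

open scoped ComplexConjugate
open Filter MeasureTheory Set
open Literature.MathematicalPhysics.QuantumLattice Literature.MathematicalPhysics.QuantumFieldTheory
open Summit.QuantumFields.YangMills.Cruxes.LatticeGapOnTrajectory.OrbitKantorovichFiniteSize

namespace Summit.QuantumFields.YangMills.Cruxes.GapToContinuum.RestatementC2

open Summit.QuantumFields.YangMills.Theses.LangevinControlUV

/-! ## R6: the re-typed crux -/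

/-- **R6 — `GapToContinuum` in slab-clustering currency** (the literal type of the landed
`gapToContinuum_slabTransfer`). -/
def GapToContinuumSlab : Prop :=
  ∀ (G : Type) [Group G] [TopologicalSpace G] [IsTopologicalGroup G] [CompactSpace G]
    [MeasurableSpace G] [BorelSpace G] (r : LatticeRep G) (sch : SpeciesScheme (YMSpecies G))
    (T : OSData (YMSpecies G) 4) (Δ : ℝ), 0 < Δ →
    (∃ (M : ℕ) (n : ℕ → ℕ), 2 ≤ M ∧ ∀ k, sch.a k = ((M : ℝ) ^ n k)⁻¹) →
    sch.HasWeakCouplingLimit →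
    Tendsto (fun k => sch.a k * sch.L k / Real.log (sch.a k)⁻¹) atTop atTop →
    sch.IsReflectionSymmetric →
    (∀ s, ∃ (q : ℕ) (K : ℝ), ∀ k,
      |sch.c s k| ≤ K * ((sch.a k)⁻¹) ^ q ∧ |sch.m s k| ≤ K * ((sch.a k)⁻¹) ^ q) →
    IsYangMillsFor r sch T →
    (∃ (p : ℕ) (K : ℝ), 0 ≤ K ∧ ∀ᶠ k in atTop,
      ∀ (w N : ℕ) (X : GaugeConfig 4 (sch.side k) G → ℂ) (B : ℝ), Measurable X →
        (∀ U, ‖X U‖ ≤ B) →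
        DependsOn X {e : Edge 4 (sch.side k) | 1 ≤ (e.1 0).val ∧ (e.1 0).val ≤ w} →
        N + 2 * w ≤ sch.L k →
          ‖osCorr (wilsonMeasure r.ρ (sch.β k)) GaugeConfig.negReflect
              (torusTimeShift (sch.side k) N) X X‖ ≤
            K * ((sch.a k)⁻¹ * ((w : ℝ) + 1) * ((sch.L k : ℝ) + 1)) ^ p * B ^ 2 *
              Real.exp (-Δ * sch.a k * N)) →
    T.HasMassGap Δ

/-- **R6 holds** — one line from the sibling bridge (this is the proof landed as
`gapToContinuum_slabTransfer`, p127362). -/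
theorem gapToContinuumSlab_holds : GapToContinuumSlab := by
  intro G _ _ _ _ _ _ r sch T Δ _ hshape hW hvol hsym hpoly hYM hclust
  obtain ⟨M, n, hM, hshape⟩ := hshape
  exact Transfer.transferHalfSym_of_uniformSlabClustering r sch hM hshape hW hvol hclust sch rfl rfl
    rfl hsym hpoly T hYM

/-- The typed crux implies nothing about R6 and conversely; but R6's hypotheses subsume the typed
ones only through `IsYangMillsFor` — `HasLatticeMassGap` is simply not used (it stays in `YangMills`
as a separate conjunct delivered by 16207). Recorded: R6 with the idle typed hypothesis added. -/
theorem gapToContinuumSlab_with_latticeGap :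
    ∀ (G : Type) [Group G] [TopologicalSpace G] [IsTopologicalGroup G] [CompactSpace G]
      [MeasurableSpace G] [BorelSpace G] (r : LatticeRep G) (sch : SpeciesScheme (YMSpecies G))
      (T : OSData (YMSpecies G) 4) (Δ : ℝ), 0 < Δ →
      (∃ (M : ℕ) (n : ℕ → ℕ), 2 ≤ M ∧ ∀ k, sch.a k = ((M : ℝ) ^ n k)⁻¹) →
      sch.HasWeakCouplingLimit → sch.HasVolumeGrowth → sch.IsReflectionSymmetric →
      Transfer.HasPolynomialRenormalisations sch → IsYangMillsFor r sch T →
      HasLatticeMassGap r sch Δ → Transfer.UniformSlabClustering r sch Δ → T.HasMassGap Δ :=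
  fun G _ _ _ _ _ _ r sch T Δ hΔ hshape hW hvol hsym hpoly hYM _ hclust =>
    gapToContinuumSlab_holds G r sch T Δ hΔ hshape hW hvol hsym hpoly hYM hclust

/-! ## Knock-on for stmt-QuantumFields-16207 -/

/-- **`OSLegsAtWeakCouplingSlab`** — stmt-QuantumFields-16207 verbatim, the witness additionally
`M`-adic, of growing physical volume, reflection-symmetric, polynomially renormalised, and clustering
uniformly on slabs at the lattice-gap rate `Δ`. -/
def OSLegsAtWeakCouplingSlab : Prop :=
  open Literature.MathematicalPhysics.QuantumFieldTheory in ∀ (G : Type) [Group G] [TopologicalSpace G] [IsTopologicalGroup G] [CompactSpace G], IsCompactSimpleLieGroup G → letI : MeasurableSpace G := borel G; haveI : BorelSpace G := ⟨rfl⟩; ∀ (r : LatticeRep G), ∀ (a : ℝ → ℝ), Continuous a → (∃ (Γ : ℝ → ℝ) (β₀ ℓ₀ c C : ℝ), 0 < ℓ₀ ∧ 0 < c ∧ (∀ β, 0 < a β) ∧ Filter.Tendsto a Filter.atTop (nhds 0) ∧ (∀ s : ℝ, 0 < s → s ≤ ℓ₀ → 0 < Γ s ∧ Γ s ≤ 1)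 ∧ ∀ (L : ℕ) [NeZero L] (β : ℝ), β₀ ≤ β → (L : ℝ) * a β ≤ ℓ₀ → let P : (Fin 4 → ZMod L) → Fin 4 → Fin 4 → GaugeConfig 4 L G → ℝ := fun x i j U => (r.N : ℝ) - (r.ρ (plaquetteHolonomy U x i j)).trace.re; let E : (GaugeConfig 4 L G → ℝ) → ℝ := fun F => wilsonExpectation (d := 4) (L := L) r.ρ β F; let cov : (GaugeConfig 4 L G → ℝ) → (GaugeConfig 4 L G → ℝ) → ℝ := fun F F' => E (fun U => F U * F' U) - E F * E F'; let dist : (Fin 4 → ZMod L) → (Fin 4 → ZMod L) → ℝ := fun x y => Real.sqrt (∑ k : Fin 4, (((x k - y k).valMinAbs : ℤ) : ℝ) ^ 2); (∀ n : ℕ, 1 ≤ n → 8 * n ≤ L → c * Γ ((n : ℝ) * a β) ≤ (n : ℝ) ^ 8 * cov (P 0 0 1) (P (Pi.single (2 : Fin 4) ((n : ℕ) : ZMod L)) 0 1) ∧ (n : ℝ) ^ 8 * cov (P 0 0 1) (P (Pi.single (2 : Fin 4) ((n : ℕ) : ZMod L)) 0 1) ≤ C * Γ ((n : ℝ) * a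 β)) ∧ (∀ (x y : Fin 4 → ZMod L) (i j i' j' : Fin 4), x ≠ y → i ≠ j → i' ≠ j' → |cov (P x i j) (P y i' j')| * dist x y ^ 8 ≤ C * Γ (dist x y * a β))) → (∃ (Γ₃ : ℝ → ℝ) (β₁ ℓ₁ c₃ : ℝ), 0 < ℓ₁ ∧ 0 < c₃ ∧ (∀ s : ℝ, 0 < s → s ≤ ℓ₁ → 0 < Γ₃ s) ∧ ∀ (L : ℕ) [NeZero L] (β : ℝ), β₁ ≤ β → (L : ℝ) * a β ≤ ℓ₁ → let P : (Fin 4 → ZMod L) → Fin 4 → Fin 4 → GaugeConfig 4 L G → ℝ := fun x i j U => (r.N : ℝ) - (r.ρ (plaquetteHolonomy U x i j)).trace.re; let E : (GaugeConfig 4 L G → ℝ) → ℝ := fun F => wilsonExpectation (d := 4) (L := L) r.ρ β F; let cov : (GaugeConfig 4 L G → ℝ) → (GaugeConfig 4 L G → ℝ) → ℝ := fun F F' => E (fun U => F U * F' U) - E F * E F'; ∀ n : ℕ, 1 ≤ n → 8 * n ≤ L → c₃ * Γ₃ ((n : ℝ) * a β) ≤ (n : ℝ) ^ 12 * |E (fun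 U => P 0 0 1 U * P (Pi.single (2 : Fin 4) ((n : ℕ) : ZMod L)) 0 1 U * P (Pi.single (3 : Fin 4) ((n : ℕ) : ZMod L)) 0 1 U) - E (P 0 0 1) * cov (P (Pi.single (2 : Fin 4) ((n : ℕ) : ZMod L)) 0 1) (P (Pi.single (3 : Fin 4) ((n : ℕ) : ZMod L)) 0 1) - E (P (Pi.single (2 : Fin 4) ((n : ℕ) : ZMod L)) 0 1) * cov (P 0 0 1) (P (Pi.single (3 : Fin 4) ((n : ℕ) : ZMod L)) 0 1) - E (P (Pi.single (3 : Fin 4) ((n : ℕ) : ZMod L)) 0 1) * cov (P 0 0 1) (P (Pi.single (2 : Fin 4) ((n : ℕ) : ZMod L)) 0 1) - E (P 0 0 1) * E (P (Pi.single (2 : Fin 4) ((n : ℕ) : ZMod L)) 0 1) * E (P (Pi.single (3 : Fin 4) ((n : ℕ) : ZMod L)) 0 1)|) → (∃ (c₁ β₂ : ℝ) (S₁ : ℝ → ℕ), 0 < c₁ ∧ ∀ A B : YMSpecies G, ∃ C : ℝ, ∀ β : ℝ, β₂ ≤ β → ∀ S n : ℕ, S₁ β ≤ S → n ≤ S → |latticeConnectedCorr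 r.ρ β (2 * S + 1) A.F B.F n| ≤ C * Real.exp (-(c₁ * a β * n))) → ∃ (sch : SpeciesScheme (YMSpecies G)) (T : OSData (YMSpecies G) 4), (∀ k, sch.a k = a (sch.β k)) ∧ sch.HasWeakCouplingLimit ∧ (∃ (M : ℕ) (n : ℕ → ℕ), 2 ≤ M ∧ ∀ k, sch.a k = ((M : ℝ) ^ n k)⁻¹) ∧ Filter.Tendsto (fun k => sch.a k * sch.L k / Real.log (sch.a k)⁻¹) Filter.atTop Filter.atTop ∧ sch.IsReflectionSymmetric ∧ (∀ s, ∃ (q : ℕ) (K : ℝ), ∀ k, |sch.c s k| ≤ K * ((sch.a k)⁻¹) ^ q ∧ |sch.m s k| ≤ K * ((sch.a k)⁻¹) ^ q) ∧ IsYangMillsFor r sch T ∧ T.IsNontrivial r.curvature ∧ T.IsNonGaussian r.curvature ∧ ∃ Δ > 0, HasLatticeMassGap r sch Δ ∧ (∃ (p : ℕ) (K : ℝ), 0 ≤ K ∧ ∀ᶠ k in Filter.atTop, ∀ (w N : ℕ) (X : GaugeConfig 4 (sch.side k) G → ℂ) (B : ℝ), Measurable X → (∀ U, ‖X U‖ ≤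 B) → DependsOn X {e : Edge 4 (sch.side k) | 1 ≤ (e.1 0).val ∧ (e.1 0).val ≤ w} → N + 2 * w ≤ sch.L k → ‖Literature.MathematicalPhysics.QuantumLattice.osCorr (wilsonMeasure r.ρ (sch.β k)) GaugeConfig.negReflect (torusTimeShift (sch.side k) N) X X‖ ≤ K * ((sch.a k)⁻¹ * ((w : ℝ) + 1) * ((sch.L k : ℝ) + 1)) ^ p * B ^ 2 * Real.exp (-Δ * sch.a k * N))

/-- The slab version implies the current 16207 (drop the added conjuncts). -/
theorem osLegsAtWeakCouplingC_of_slab (h : OSLegsAtWeakCouplingSlab) : OSLegsAtWeakCouplingC := by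
  intro G _ _ _ _ hG r a ha hPa hSk hCl
  obtain ⟨sch, T, hunits, hW, -, -, -, -, hYM, hNT, hNG, Δ, hΔ, hlat, -⟩ :=
    h G hG r a ha hPa hSk hCl
  exact ⟨sch, T, hunits, hW, hYM, hNT, hNG, Δ, hΔ, hlat⟩

/-- **The assembly re-closes under R6**:
`FemtoCurvatureTwoPointC → FemtoCurvatureSkewnessC → LatticeGapInUVUnitsC → OSLegsAtWeakCouplingSlab →
GapToContinuumSlab → YangMills` (same proof shape as the route's `closes`). -/
theorem closes_restatedSlab (hUV : FemtoCurvatureTwoPointC) (hSkew : FemtoCurvatureSkewnessC)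
    (hIR : LatticeGapInUVUnitsC) (hOS : OSLegsAtWeakCouplingSlab) (hGap : GapToContinuumSlab) :
    YangMills := by
  intro G _ _ _ _ hG
  letI : MeasurableSpace G := borel G
  haveI : BorelSpace G := ⟨rfl⟩
  obtain ⟨r⟩ := hG.2
  obtain ⟨a, ha, hPa, hSk⟩ := hSkew G hG r (hUV G hG r)
  have hCl := hIR G hG r a ha hPa
  obtain ⟨sch, T, _, hW, hshape, hvol, hsym, hpoly, hYM, hNT, hNG, Δ, hΔ, hlat, hclust⟩ :=
    hOS G hG r a ha hPa hSk hCl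
  exact ⟨r, sch, T, hW, hYM, hNT, hNG, Δ, hΔ,
    hGap G r sch T Δ hΔ hshape hW hvol hsym hpoly hYM hclust, hlat⟩

/-- Since `GapToContinuumSlab` is a theorem, the restated assembly has FOUR genuine hypotheses. -/
theorem closes_restatedSlab' (hUV : FemtoCurvatureTwoPointC) (hSkew : FemtoCurvatureSkewnessC)
    (hIR : LatticeGapInUVUnitsC) (hOS : OSLegsAtWeakCouplingSlab) : YangMills :=
  closes_restatedSlab hUV hSkew hIR hOS gapToContinuumSlab_holds

/-! ## Consistency of the `M`-adic clause with a continuous unit map -/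

/-- **`M`-adic weak-coupling levels of a continuous unit map.**  If `a : ℝ → ℝ` is continuous,
positive and tends to `0` at `+∞` (the unit map of the C-variants), then for every `M ≥ 2` there are
couplings `β_k → +∞` and exponents `n_k` with `a (β_k) = M^{-n_k}` exactly (intermediate value
theorem on `[k, b_k]`).  So a witness scheme with `sch.a k = a (sch.β k)`, `M`-adic spacings AND
`HasWeakCouplingLimit` exists at the level of the scheme data. -/
theorem exists_MAdic_weakCoupling {a : ℝ → ℝ} (ha : Continuous a) (hpos : ∀ β, 0 < a β)
    (hlim : Tendsto a atTop (nhds 0)) {M : ℕ} (hM : 2 ≤ M) :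
    ∃ (β : ℕ → ℝ) (n : ℕ → ℕ), Tendsto β atTop atTop ∧ ∀ k, a (β k) = ((M : ℝ) ^ n k)⁻¹ := by
  have hM1 : (1 : ℝ) < M := by exact_mod_cast hM
  have hM0 : (0 : ℝ) < M := by linarith
  -- for each level `k`: an exponent with `M^{-n} < a k`, then a coupling `β ≥ k` hitting it
  have key : ∀ k : ℕ, ∃ (β : ℝ) (n : ℕ), (k : ℝ) ≤ β ∧ a β = ((M : ℝ) ^ n)⁻¹ := by
    intro k
    obtain ⟨n, hn⟩ : ∃ n : ℕ, ((M : ℝ) ^ n)⁻¹ < a k := by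
      have h : Tendsto (fun n : ℕ => ((M : ℝ) ^ n)⁻¹) atTop (nhds 0) :=
        tendsto_inv_atTop_zero.comp (tendsto_pow_atTop_atTop_of_one_lt hM1)
      exact (h.eventually (gt_mem_nhds (hpos k))).exists
    have hq : 0 < ((M : ℝ) ^ n)⁻¹ := by positivity
    obtain ⟨b, hb⟩ : ∃ b : ℝ, (k : ℝ) ≤ b ∧ a b < ((M : ℝ) ^ n)⁻¹ := by
      have h1 : ∀ᶠ x in atTop, a x < ((M : ℝ) ^ n)⁻¹ := hlim.eventually (gt_mem_nhds hq)
      obtain ⟨b, hb⟩ := (h1.and (eventually_ge_atTop (k : ℝ))).exists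
      exact ⟨b, hb.2, hb.1⟩
    have hIVT : ((M : ℝ) ^ n)⁻¹ ∈ a '' Icc (k : ℝ) b := by
      have hsub := intermediate_value_Icc' hb.1 ha.continuousOn
      exact hsub ⟨hb.2.le, hn.le⟩
    obtain ⟨β, hβmem, hβ⟩ := hIVT
    exact ⟨β, n, hβmem.1, hβ⟩
  choose β n hβ using key
  refine ⟨β, n, ?_, fun k => (hβ k).2⟩
  exact tendsto_atTop_mono (fun k => (hβ k).1) tendsto_natCast_atTop_atTop

end Summit.QuantumFields.YangMills.Cruxes.GapToContinuum.RestatementC2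

end
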